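import Literature.Analysis.FluidPDE.KNSSRegularityWindowOfProp41
import Literature.Analysis.FluidPDE.OseenHeatKernelBridge
import Literature.Analysis.FluidPDE.NSBoundedMildOseenAssembly
import Literature.Analysis.FluidPDE.SpaceTimeCalculus
import HarnessLib

/-!
# KNSS 2009, Proposition 4.1 for restarted bounded mild solutions from the local theory (L):
# one named fact for both the Liouville chain and the critical-Besov chain

Analysis/FluidPDE proofs file (everything proved; no definitions, no named facts) on the
discharge path of `Literature.Analysis.FluidPDE.KNSS2009_mild_regularity`
(`KNSSRegularityGalilean.lean`; Koch–Nadirashvili–Seregin–Šverák, Acta Math. 203 (2009) =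
arXiv:0709.3599v1, §4: the regularity (4.10)–(4.11) and the vorticity equation (4.8) of bounded
mild solutions, constants uniform in the solution). After `KNSSMildRegularity.lean` /
`KNSSMildVorticityProofs.lean` this fact — and with it the window and ancient regularity facts of
§4 consumed by KNSS's Theorems 5.2–5.3 (`KNSSRegularityWindowOfProp41.lean`) — rests on the single
named fact `KNSS2009_prop41_mild` (Proposition 4.1 with (4.6) for the tree's restarted-mild
fields `IsKNSSDriftMild T N V 0`, heat-flow realisation `oseenHeat` of `e^{τΔ}P∇·`). Independently,
the tree's critical-Besov continuation chain (`NSBoundedMildOseen*.lean`, Gallagher–Koch–Planchon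
2016 via KNSS Prop. 4.1) rests on the single named fact (L) `knss2009_local_smoothing ℝ³`
(`NSBoundedMildSmoothing.lean`: Proposition 4.1 in its quantitative short-time form — smooth
local solutions of the Oseen integral equation `v(t) = e^{ν(t−s)Δ}a − B^ν_s(v,v)(t)` from bounded
data, jointly `C^{k+l}`, with `(ν(t−s))^{k/2}(t−s)^l‖∇ᵏₓ∂ₜˡv‖ ≤ C(k,l)M` on `(s, s + ε(k,l)ν/M²)`,
kernel realisation `oseenKernel`).

This file **proves `KNSS2009_prop41_mild` from (L)** (`KNSS2009_prop41_mild_of_local`), so that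
both chains now rest on the one printed statement (L):

* `KNSS2009_mild_regularity_of_local : knss2009_local_smoothing ℝ³ → KNSS2009_mild_regularity`,
* `KNSS2009_regularity_boundedWeak_ancient_of_local : knss2009_local_smoothing ℝ³ →
  KNSS2009_regularity_boundedWeak_ancient` (the §4 input of Theorems 5.2–5.3).

## The proof

Let `V` be restarted-mild with bound `N` on `(0, T)` (`IsKNSSDriftMild T N V 0`). By the bridge
between the two realisations of `e^{τΔ}P∇·` (`OseenHeatKernelBridge.lean`,
`IsKNSSDriftMild.eq_heatExtension_sub_oseenDuhamel_three`), `V` solves the Oseen integral equation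
`V(t) = e^{(t−s)Δ}V(s) − B¹_s(V,V)(t)` *pointwise* for all `0 < s < t < T`: `V` is its own canonical
representative on every window `(s, T)`.
1. **Joint smoothness.** (P) `knss2009_smoothing ℝ³`, which the tree derives from (L)
   (`knss2009_smoothing_three_of_local`: uniqueness of bounded solutions and restart), applied on
   `(s, T)` with datum `V(s)`, `‖V(s)‖_∞ ≤ N`, makes the representative — i.e. `V` — jointly `C^∞`
   on `(s, T) × ℝ³`; `s ↓ 0`.
2. **(4.6), `l = 0`.** For `0 < s < t < T` with `N²(t − s) < ε(k,0)` (and `N > 0`; `N = 0` forces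
   `V = 0`), (L) at `(k, 0)` and uniqueness (`exists_local_smooth_representative`) give
   `V = v` on `(s, min(s + ε/N², T))` for the smooth local solution `v` from `V(s)`, whence
   `(t−s)^{k/2}‖∇ᵏV(t, x)‖ ≤ C(k,0) N`.
3. **(4.6), `l = 1`, integrated.** Likewise (L) at `(k, 1)` gives
   `‖∇ᵏₓ∂ₜV(τ, x)‖ ≤ C(k,1) N (τ−s)^{-(k/2+1)}` on the window; since `V` is jointly smooth,
   `τ ↦ ∇ᵏV(τ, x)` is differentiable with derivative `∇ᵏₓ(∂ₜV)(τ, x)` (exchange of `∂ₜ` with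
   `∇ᵏₓ`, `IsSmoothSpaceTimeOn.hasDerivAt_iteratedFDeriv_slice` below, by induction on `k` from the
   tree's operator-valued exchange `hasDerivAt_fderiv_slice_clm` through the currying isometry
   `iteratedFDeriv_succ_eq_comp_right`), and the mean value inequality on `[t, t']` with the
   monotone weight yields `(t−s)^{k/2+1}‖∇ᵏV(t', x) − ∇ᵏV(t, x)‖ ≤ C(k,1) N (t' − t)`.
The constants of `KNSS2009_prop41_mild` are `ε(k) = min(ε(k,0), ε(k,1))`,
`C(k) = max(C(k,0), C(k,1))`.

## Mathlib / tree search

Tree: `KNSS2009_prop41_mild`, `KNSS2009_mild_regularity_of_prop41'`,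
`KNSS2009_regularity_boundedWeak_ancient_of_prop41'`, `KNSS2009_weak_driftMild_holds`
(`KNSSMildRegularity`, `KNSSMildVorticityProofs`, `KNSSWeakDriftMildProofs`);
`knss2009_local_smoothing`, `exists_local_smooth_representative` (`NSBoundedMildSmoothing`),
`knss2009_smoothing_three_of_local` (`NSBoundedMildOseenAssembly`);
`IsKNSSDriftMild.eq_heatExtension_sub_oseenDuhamel_three` (`OseenHeatKernelBridge`);
`IsSmoothSpaceTimeOn.hasDerivAt_fderiv_slice_clm`, `.isSmoothSpaceTimeOn_fderiv_of_isOpen`,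
`.hasDerivAt_timeLine`, `.contDiff_slice` (`SpaceTimeCalculus`, `TaoEnstrophyLocalisation`).
Mathlib: `iteratedFDeriv_succ_eq_comp_right`, `continuousMultilinearCurryRightEquiv'`,
`norm_image_sub_le_of_norm_deriv_le_segment'`, `Filter.EventuallyEq.deriv_eq`,
`contDiffOn_of_locally_contDiffOn`, `iteratedDeriv_zero`, `iteratedDeriv_one`.

## References

* G. Koch, N. Nadirashvili, G. Seregin, V. Šverák, *Liouville theorems for the Navier–Stokes
  equations and applications*, Acta Math. 203 (2009) 83–105 = arXiv:0709.3599v1, §4 p. 8: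
  (4.3)–(4.6), Proposition 4.1, Remark 4.2, and the closing paragraph (4.8)–(4.11).
  [KochNadirashviliSereginSverak2009]
* Y. Giga, K. Inui, S. Matsui, *On the Cauchy problem for the Navier–Stokes equations with
  nondecaying initial data*, Quaderni di Matematica 4 (1999), Thm. 1 (smoothness of bounded mild
  solutions; KNSS's reference [Giga]).
-/

noncomputable section

open MeasureTheory Set Function Filter TopologicalSpace InnerProductSpace Metric
open _root_.Topology
open scoped RealInnerProductSpace ContDiff NNReal ENNReal

namespace Literature.Analysis.FluidPDE

universe u

/-! ### Exchange of `∂ₜ` with `∇ᵏₓ` for jointly smooth fields on an open time set -/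

section Exchange

/-- **Exchange of `∂ₜ` with the iterated spatial derivative.** For a field `w` jointly smooth on
an open time set `S` and `t ∈ S`, the time line of the `k`-th slice derivative
`s ↦ ∇ᵏ(w s)(x)` has derivative `∇ᵏ(∂ₜw(t, ·))(x)` at `t`: `∂ₜ∇ᵏₓ = ∇ᵏₓ∂ₜ` (Evans, *PDE*,
App. C.1; induction on `k` from the operator-valued exchange `d/dt D(w s)(x) = D(∂ₜw(t,·))(x)` of
`SpaceTimeCalculus`, through the currying isometry `∇ᵏ⁺¹f = curry⁻¹ ∘ ∇ᵏ(Df)`). The space and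
the target are taken in a common universe so that the induction may pass to the field `Dw` with
values in `X →L[ℝ] F`. [folklore] -/
theorem IsSmoothSpaceTimeOn.hasDerivAt_iteratedFDeriv_slice {X F : Type u} [NormedAddCommGroup X]
    [NormedSpace ℝ X] [NormedAddCommGroup F] [NormedSpace ℝ F] {S : Set ℝ} (hS : IsOpen S)
    (k : ℕ) {w : ℝ → X → F} (h : IsSmoothSpaceTimeOn S w) {t : ℝ} (ht : t ∈ S) (x : X) :
    HasDerivAt (fun s => iteratedFDeriv ℝ k (w s) x)
      (iteratedFDeriv ℝ k (fun y => deriv (fun s => w s y) t) x) t := by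
  induction k generalizing F with
  | zero =>
    -- order zero: the time line itself, through the order-zero isometry
    have h0 := h.hasDerivAt_timeLine hS ht x
    have hL := ((continuousMultilinearCurryFin0 ℝ X F).symm.toContinuousLinearEquiv :
      F →L[ℝ] (X [×0]→L[ℝ] F)).hasFDerivAt.comp_hasDerivAt t h0
    have e1 : (fun s => iteratedFDeriv ℝ 0 (w s) x) =
        ((continuousMultilinearCurryFin0 ℝ X F).symm.toContinuousLinearEquiv :
          F →L[ℝ] (X [×0]→L[ℝ] F)) ∘ fun s => w s x := by
      funext s; ext m; simp
    have e2 : iteratedFDeriv ℝ 0 (fun y => deriv (fun s => w s y) t) x =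
        ((continuousMultilinearCurryFin0 ℝ X F).symm.toContinuousLinearEquiv :
          F →L[ℝ] (X [×0]→L[ℝ] F)) (deriv (fun s => w s x) t) := by
      ext m; simp
    rw [e1, e2]
    exact hL
  | succ k ih =>
    -- the field of slice derivatives, with values in `X →L[ℝ] F`
    set w' : ℝ → X → (X →L[ℝ] F) := fun s y => fderiv ℝ (w s) y with hw'
    have hw's : IsSmoothSpaceTimeOn S w' := h.isSmoothSpaceTimeOn_fderiv_of_isOpen hS
    have ih' := ih hw's
    -- `∂ₜ(Dw) = D(∂ₜw)` on `S`
    have hexch : ∀ y, deriv (fun s => w' s y) t = fderiv ℝ (fun z => deriv (fun s => w s z) t) y :=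
      fun y => (h.hasDerivAt_fderiv_slice_clm hS ht y).deriv
    have hfun : (fun y => deriv (fun s => w' s y) t) =
        fun y => fderiv ℝ (fun z => deriv (fun s => w s z) t) y := funext hexch
    rw [hfun] at ih'
    -- through the currying isometry
    set L := (continuousMultilinearCurryRightEquiv' ℝ k X F).symm with hLdef
    have hcomp := (L.toContinuousLinearEquiv : (X [×k]→L[ℝ] (X →L[ℝ] F)) →L[ℝ]
      (X [×(k + 1)]→L[ℝ] F)).hasFDerivAt.comp_hasDerivAt t ih'
    have e1 : (fun s => iteratedFDeriv ℝ (k + 1) (w s) x) =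
        (L.toContinuousLinearEquiv : (X [×k]→L[ℝ] (X →L[ℝ] F)) →L[ℝ] (X [×(k + 1)]→L[ℝ] F)) ∘
          fun s => iteratedFDeriv ℝ k (w' s) x := by
      funext s
      rw [iteratedFDeriv_succ_eq_comp_right]
      rfl
    have e2 : iteratedFDeriv ℝ (k + 1) (fun y => deriv (fun s => w s y) t) x =
        (L.toContinuousLinearEquiv : (X [×k]→L[ℝ] (X →L[ℝ] F)) →L[ℝ] (X [×(k + 1)]→L[ℝ] F))
          (iteratedFDeriv ℝ k (fun y => fderiv ℝ (fun z => deriv (fun s => w s z) t) y) x) := by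
      rw [iteratedFDeriv_succ_eq_comp_right]
      rfl
    rw [e1, e2]
    exact hcomp

/-- **Mean value form of the exchange**: for a field jointly smooth on an open time set `S`
containing `[t, t']`, if `‖∇ᵏₓ(∂ₜw)(τ, x)‖ ≤ B` for `τ ∈ [t, t']`, then
`‖∇ᵏ(w t')(x) − ∇ᵏ(w t)(x)‖ ≤ B (t' − t)`. [folklore] -/
theorem IsSmoothSpaceTimeOn.norm_iteratedFDeriv_slice_sub_le {X F : Type u} [NormedAddCommGroup X]
    [NormedSpace ℝ X] [NormedAddCommGroup F] [NormedSpace ℝ F] {S : Set ℝ} (hS : IsOpen S)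
    (k : ℕ) {w : ℝ → X → F} (h : IsSmoothSpaceTimeOn S w) {t t' : ℝ} (htt' : t ≤ t')
    (hI : Icc t t' ⊆ S) (x : X) {B : ℝ}
    (hB : ∀ τ ∈ Icc t t', ‖iteratedFDeriv ℝ k (fun y => deriv (fun s => w s y) τ) x‖ ≤ B) :
    ‖iteratedFDeriv ℝ k (w t') x - iteratedFDeriv ℝ k (w t) x‖ ≤ B * (t' - t) := by
  have hderiv : ∀ τ ∈ Icc t t', HasDerivWithinAt (fun s => iteratedFDeriv ℝ k (w s) x)
      (iteratedFDeriv ℝ k (fun y => deriv (fun s => w s y) τ) x) (Icc t t') τ := fun τ hτ =>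
    (h.hasDerivAt_iteratedFDeriv_slice hS k (hI hτ) x).hasDerivWithinAt
  exact norm_image_sub_le_of_norm_deriv_le_segment' hderiv
    (fun τ hτ => hB τ (Ico_subset_Icc_self hτ)) t' (right_mem_Icc.2 htt')

end Exchange

/-! ### Proposition 4.1 for restarted bounded mild solutions from the local theory (L) -/

section Prop41

/-- The `L^∞` norm of a slice of a restarted-mild field in the window is at most `N`. [folklore] -/
theorem IsKNSSDriftMild.eLpNorm_slice_le {E : Type*} [NormedAddCommGroup E] [InnerProductSpace ℝ E]
    [FiniteDimensional ℝ E] [MeasurableSpace E] [BorelSpace E] {T N : ℝ} {U : ℝ → E → E}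
    {b : ℝ → E} (h : IsKNSSDriftMild T N U b) {t : ℝ} (ht : t ∈ Ioo 0 T) :
    eLpNorm (U t) ∞ volume ≤ ENNReal.ofReal N := by
  rw [eLpNorm_exponent_top]
  exact eLpNormEssSup_le_of_ae_bound (Eventually.of_forall (h.norm_le t ht))

/-- **A restarted bounded mild solution is jointly smooth**, given (L): by the bridge,
`V` is its own canonical representative `e^{(t−s)Δ}V(s) − B¹_s(V,V)(t)` on every window
`(s, T)`, which (P) `knss2009_smoothing ℝ³` (from (L), `knss2009_smoothing_three_of_local`) makes
jointly `C^∞` on `(s, T) × ℝ³`; let `s ↓ 0` (KNSS 2009, Prop. 4.1; Giga–Inui–Matsui 1999,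
Thm. 1 (iii)). [cite: KochNadirashviliSereginSverak2009, Prop. 4.1 (arXiv:0709.3599v1 p. 8)] -/
theorem IsKNSSDriftMild.isSmoothSpaceTimeOn_of_local
    (hL : knss2009_local_smoothing (EuclideanSpace ℝ (Fin 3))) {T N : ℝ}
    {V : ℝ → EuclideanSpace ℝ (Fin 3) → EuclideanSpace ℝ (Fin 3)} (hV : IsKNSSDriftMild T N V 0) :
    IsSmoothSpaceTimeOn (Ioo 0 T) V := by
  have hP := knss2009_smoothing_three_of_local hL
  have hN : 0 ≤ N := hV.nonneg
  have hmeas : ∀ s T₁ : ℝ, AEStronglyMeasurable (uncurry V)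
      ((volume : Measure (ℝ × EuclideanSpace ℝ (Fin 3))).restrict (Ioo s T₁ ×ˢ univ)) :=
    fun s T₁ => hV.measurable.aestronglyMeasurable
  -- joint smoothness on every window `(s, T)`, `0 < s`
  have hwin : ∀ ⦃s : ℝ⦄, 0 < s → s < T → IsSmoothSpaceTimeOn (Ioo s T) V := by
    intro s hs hsT
    have hsl : AEStronglyMeasurable (V s) volume :=
      (hV.measurable.comp (measurable_const.prodMk measurable_id)).aestronglyMeasurable
    have hsM : eLpNorm (V s) ∞ volume ≤ ENNReal.ofReal N := hV.eLpNorm_slice_le ⟨hs, hsT⟩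
    have hbd : ∀ t ∈ Ioo s T, eLpNorm (V t) ∞ volume ≤ ENNReal.ofReal N := fun t ht =>
      hV.eLpNorm_slice_le ⟨hs.trans ht.1, ht.2⟩
    have hsol : ∀ t ∈ Ioo s T, V t =ᵐ[volume] fun x =>
        UnboundedOperators.heatExtension (V s) (1 * (t - s)) x - oseenDuhamel 1 s V V t x :=
      fun t ht => (hV.eq_heatExtension_sub_oseenDuhamel_three hs ht.1 ht.2).2
    have h1 := (hP one_pos hsT hN hsl hsM (hmeas s T) hbd hsol).1
    refine h1.congr ?_
    rintro ⟨t, x⟩ ⟨ht, -⟩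
    simp only [uncurry_apply_pair]
    exact (hV.eq_heatExtension_sub_oseenDuhamel_three hs ht.1 ht.2).1 x |>.trans (by rw [one_mul])
  -- glue along `s ↓ 0`
  refine contDiffOn_of_locally_contDiffOn fun z hz => ?_
  obtain ⟨ht, -⟩ := mem_prod.1 hz
  refine ⟨Ioo (z.1 / 2) T ×ˢ univ, isOpen_Ioo.prod isOpen_univ,
    mk_mem_prod ⟨by linarith [ht.1], ht.2⟩ (mem_univ _), ?_⟩
  have hsub : (Ioo 0 T ×ˢ (univ : Set (EuclideanSpace ℝ (Fin 3)))) ∩ Ioo (z.1 / 2) T ×ˢ univ =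
      Ioo (z.1 / 2) T ×ˢ univ := by
    rw [inter_eq_right]
    exact prod_mono (Ioo_subset_Ioo (by linarith [ht.1]) le_rfl) Subset.rfl
  rw [hsub]
  exact hwin (half_pos ht.1) (by linarith [ht.1, ht.2])

/-- **KNSS 2009, Proposition 4.1 with (4.6) for restarted bounded mild solutions, from the local
theory (L).** `KNSS2009_prop41_mild` (joint smoothness on `(0, T) × ℝ³`; on short windows
`N²(t − s) < ε(k)`: `(t−s)^{k/2}‖∇ᵏV(t)‖ ≤ C(k)N` and
`(t−s)^{k/2+1}‖∇ᵏV(t') − ∇ᵏV(t)‖ ≤ C(k)N(t' − t)`) follows from `knss2009_local_smoothing ℝ³` with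
`ε(k) = min(ε(k,0), ε(k,1))`, `C(k) = max(C(k,0), C(k,1))`: the bridge makes `V` a pointwise
solution of the Oseen integral equation, uniqueness identifies it on each short window with the
smooth local solution of (L) from the datum `V(s)` (`‖V(s)‖_∞ ≤ N`), and for `l = 1` the bound on
`∇ᵏₓ∂ₜV` is integrated in time after exchanging `∂ₜ` with `∇ᵏₓ`. [cite: KochNadirashviliSereginSverak2009, Prop. 4.1 with (4.6) (arXiv:0709.3599v1 p. 8)] -/
theorem KNSS2009_prop41_mild_of_local (hL : knss2009_local_smoothing (EuclideanSpace ℝ (Fin 3))) :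
    KNSS2009_prop41_mild := by
  intro k
  obtain ⟨ε₀, hε₀, C₀, hC₀, hL0⟩ := hL k 0
  obtain ⟨ε₁, hε₁, C₁, hC₁, hL1⟩ := hL k 1
  refine ⟨min ε₀ ε₁, lt_min hε₀ hε₁, max C₀ C₁, le_max_of_le_left hC₀, fun T N V hV => ?_⟩
  have hsmooth : IsSmoothSpaceTimeOn (Ioo 0 T) V := hV.isSmoothSpaceTimeOn_of_local hL
  refine ⟨hsmooth, fun s hs t ht hsmall => ?_⟩
  have hN : 0 ≤ N := hV.nonneg
  have hts : 0 < t - s := sub_pos.2 ht.1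
  rcases hN.eq_or_lt with hN0 | hNpos
  · -- `N = 0`: the field vanishes on the window
    have hV0 : ∀ τ ∈ Ioo 0 T, V τ = fun _ => 0 := fun τ hτ => funext fun y =>
      norm_le_zero_iff.1 (by simpa [← hN0] using hV.norm_le τ hτ y)
    have htT : t ∈ Ioo 0 T := ⟨hs.1.trans ht.1, ht.2⟩
    refine ⟨fun x => ?_, fun t' ht' _ x => ?_⟩
    · rw [hV0 t htT, iteratedFDeriv_fun_zero, ← hN0]; simp
    · rw [hV0 t htT, hV0 t' ⟨htT.1.trans_le ht'.1, ht'.2⟩, iteratedFDeriv_fun_zero, ← hN0]; simp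
  -- `N > 0`: the data of the window `(s, T)` from the datum `V(s)`
  have hN2 : 0 < N ^ 2 := by positivity
  have hsl : AEStronglyMeasurable (V s) volume :=
    (hV.measurable.comp (measurable_const.prodMk measurable_id)).aestronglyMeasurable
  have hsM : eLpNorm (V s) ∞ volume ≤ ENNReal.ofReal N := hV.eLpNorm_slice_le hs
  have hmeas : AEStronglyMeasurable (uncurry V)
      ((volume : Measure (ℝ × EuclideanSpace ℝ (Fin 3))).restrict (Ioo s T ×ˢ univ)) :=
    hV.measurable.aestronglyMeasurable
  have hbd : ∀ τ ∈ Ioo s T, eLpNorm (V τ) ∞ volume ≤ ENNReal.ofReal N := fun τ hτ =>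
    hV.eLpNorm_slice_le ⟨hs.1.trans hτ.1, hτ.2⟩
  have hsol : ∀ τ ∈ Ioo s T, V τ =ᵐ[volume] fun x =>
      UnboundedOperators.heatExtension (V s) (1 * (τ - s)) x - oseenDuhamel 1 s V V τ x :=
    fun τ hτ => (hV.eq_heatExtension_sub_oseenDuhamel_three hs.1 hτ.1 hτ.2).2
  have hrepV : ∀ τ ∈ Ioo s T, ∀ x,
      UnboundedOperators.heatExtension (V s) (1 * (τ - s)) x - oseenDuhamel 1 s V V τ x = V τ x :=
    fun τ hτ x => by
      rw [one_mul]; exact ((hV.eq_heatExtension_sub_oseenDuhamel_three hs.1 hτ.1 hτ.2).1 x).symm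
  -- membership in the short windows: `N²(τ − s) < ε'` means `τ < s + ε'/N²`
  have hlt_of_small : ∀ {ε' τ : ℝ}, N ^ 2 * (τ - s) < ε' → τ < s + ε' * 1 / N ^ 2 := by
    intro ε' τ h
    have h1 : τ - s < ε' / N ^ 2 := by
      rw [lt_div_iff₀ hN2, mul_comm]; exact h
    rw [mul_one]; linarith
  refine ⟨fun x => ?_, fun t' ht' hsmall' x => ?_⟩
  · -- (4.6), `l = 0`: (L) at `(k, 0)` and uniqueness
    obtain ⟨v, -, -, hrep, -, hvbd⟩ :=
      exists_local_smooth_representative hL0 one_pos hNpos hC₀ hsl hsM hmeas hbd hsol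
    have hε : N ^ 2 * (t - s) < ε₀ := hsmall.trans_le (min_le_left _ _)
    have htw : t ∈ Ioo s (min (s + ε₀ * 1 / N ^ 2) T) := ⟨ht.1, lt_min (hlt_of_small hε) ht.2⟩
    have htw' : t ∈ Ioo s (s + ε₀ * 1 / N ^ 2) := ⟨ht.1, hlt_of_small hε⟩
    have hVv : V t = v t := funext fun y => by rw [← hrepV t ht y, hrep t htw y]
    have hb := hvbd t htw' x
    have e : (fun y => iteratedDeriv 0 (fun τ => v τ y) t) = v t := by
      funext y; rw [iteratedDeriv_zero]
    rw [e, one_mul, pow_zero, mul_one] at hb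
    rw [hVv]
    exact hb.trans (mul_le_mul_of_nonneg_right (le_max_left _ _) hN)
  · -- (4.6), `l = 1`, integrated: (L) at `(k, 1)`, uniqueness, exchange of `∂ₜ` and `∇ᵏ`
    obtain ⟨v, -, -, hrep, -, hvbd⟩ :=
      exists_local_smooth_representative hL1 one_pos hNpos hC₁ hsl hsM hmeas hbd hsol
    have hε' : N ^ 2 * (t' - s) < ε₁ := hsmall'.trans_le (min_le_right _ _)
    have ht'w : t' < s + ε₁ * 1 / N ^ 2 := hlt_of_small hε'
    -- the open time set `I ∋ [t, t']` on which `V = v`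
    set I : Set ℝ := Ioo s (min (s + ε₁ * 1 / N ^ 2) T) with hI
    have hIsub : Icc t t' ⊆ I := fun τ hτ =>
      ⟨ht.1.trans_le hτ.1, lt_min (hτ.2.trans_lt ht'w) (hτ.2.trans_lt ht'.2)⟩
    have hI0T : I ⊆ Ioo 0 T := fun τ hτ => ⟨hs.1.trans hτ.1, hτ.2.trans_le (min_le_right _ _)⟩
    have hVv : ∀ τ ∈ I, ∀ y, V τ y = v τ y := fun τ hτ y => by
      rw [← hrepV τ ⟨hτ.1, hτ.2.trans_le (min_le_right _ _)⟩ y, hrep τ hτ y]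
    -- the bound on `∇ᵏₓ ∂ₜ V` along `[t, t']`, with the monotone weight
    have hB : ∀ τ ∈ Icc t t', ‖iteratedFDeriv ℝ k (fun y => deriv (fun σ => V σ y) τ) x‖ ≤
        C₁ * N * (t - s) ^ (-((k : ℝ) / 2 + 1)) := by
      intro τ hτ
      have hτI : τ ∈ I := hIsub hτ
      have hτw : τ ∈ Ioo s (s + ε₁ * 1 / N ^ 2) := ⟨hτI.1, hτI.2.trans_le (min_le_left _ _)⟩
      have hτs : 0 < τ - s := sub_pos.2 hτI.1
      have hderiv_eq : (fun y => deriv (fun σ => V σ y) τ) = fun y => deriv (fun σ => v σ y) τ := by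
        funext y
        refine Filter.EventuallyEq.deriv_eq ?_
        filter_upwards [isOpen_Ioo.mem_nhds hτI] with σ hσ
        exact hVv σ hσ y
      have hb := hvbd τ hτw x
      have e : (fun y => iteratedDeriv 1 (fun σ => v σ y) τ) = fun y => deriv (fun σ => v σ y) τ := by
        funext y; rw [iteratedDeriv_one]
      rw [e, one_mul, pow_one, ← Real.rpow_add_one hτs.ne'] at hb
      rw [hderiv_eq]
      have h1 : ‖iteratedFDeriv ℝ k (fun y => deriv (fun σ => v σ y) τ) x‖ ≤
          C₁ * N * (τ - s) ^ (-((k : ℝ) / 2 + 1)) :=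
        le_mul_rpow_neg_of_rpow_mul_le hτs hb
      refine h1.trans (mul_le_mul_of_nonneg_left ?_ (by positivity))
      exact Real.rpow_le_rpow_of_nonpos hts (by linarith [hτ.1])
        (neg_nonpos.2 (by positivity))
    have hmv := hsmooth.norm_iteratedFDeriv_slice_sub_le isOpen_Ioo k ht'.1
      (hIsub.trans hI0T) x hB
    -- conclusion
    have hexp : 0 < (t - s) ^ ((k : ℝ) / 2 + 1) := Real.rpow_pos_of_pos hts _
    have htt' : 0 ≤ t' - t := sub_nonneg.2 ht'.1
    calc (t - s) ^ ((k : ℝ) / 2 + 1) * ‖iteratedFDeriv ℝ k (V t') x - iteratedFDeriv ℝ k (V t) x‖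
        ≤ (t - s) ^ ((k : ℝ) / 2 + 1) * (C₁ * N * (t - s) ^ (-((k : ℝ) / 2 + 1)) * (t' - t)) :=
          mul_le_mul_of_nonneg_left hmv hexp.le
      _ = C₁ * N * (t' - t) * ((t - s) ^ ((k : ℝ) / 2 + 1) * ((t - s) ^ ((k : ℝ) / 2 + 1))⁻¹) := by
          rw [Real.rpow_neg hts.le]; ring
      _ = C₁ * N * (t' - t) := by rw [mul_inv_cancel₀ hexp.ne', mul_one]
      _ ≤ max C₀ C₁ * N * (t' - t) :=
          mul_le_mul_of_nonneg_right (mul_le_mul_of_nonneg_right (le_max_right _ _) hN) htt'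

/-- **KNSS's §4 regularity of bounded mild solutions from the local theory (L) alone**:
`KNSS2009_mild_regularity` (the zero-drift case of the drift-mild smoothing half: smooth
divergence-free slices with `‖∇ᵏV‖ ≤ C(k,δ)`, `‖∇ᵏV(t) − ∇ᵏV(s)‖ ≤ L(k,δ)|t − s|` on `(δ, T)` and
the vorticity equation (4.8)) follows from `knss2009_local_smoothing ℝ³`
(`KNSS2009_prop41_mild_of_local` with the tree's `KNSS2009_mild_regularity_of_prop41'`, whose
vorticity input (4.8) is proved in `KNSSMildVorticityProofs`). [cite: KochNadirashviliSereginSverak2009, §4 (4.8)–(4.11) with Prop. 4.1 (arXiv:0709.3599v1 p. 8)] -/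
theorem KNSS2009_mild_regularity_of_local
    (hL : knss2009_local_smoothing (EuclideanSpace ℝ (Fin 3))) :
    KNSS2009_mild_regularity :=
  KNSS2009_mild_regularity_of_prop41' (KNSS2009_prop41_mild_of_local hL)

/-- **The ancient regularity fact of §4 (the input of KNSS's Theorems 5.2–5.3) from the local
theory (L) alone** (Lemma 3.1, Galilean covariance and (4.8) being proved in the tree:
`KNSS2009_regularity_boundedWeak_ancient_of_prop41_mild`, `KNSSRegularityWindowOfProp41`).
[cite: KochNadirashviliSereginSverak2009, §5 proof of Thm 5.2, first sentence (arXiv:0709.3599v1 p. 10), with §4 and Lemma 3.1] -/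
theorem KNSS2009_regularity_boundedWeak_ancient_of_local
    (hL : knss2009_local_smoothing (EuclideanSpace ℝ (Fin 3))) :
    KNSS2009_regularity_boundedWeak_ancient :=
  KNSS2009_regularity_boundedWeak_ancient_of_prop41_mild (KNSS2009_prop41_mild_of_local hL)

end Prop41

end Literature.Analysis.FluidPDE

end
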